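import Summits.BirchSwinnertonDyer.BirchSwinnertonDyer.Theorems.KimAtThreeShallowEqDeepMultTwoExpFineKato
import Summits.BirchSwinnertonDyer.BirchSwinnertonDyer.Theorems.KimAtThreeShallowEqDeepAnomalousRows
import Summits.BirchSwinnertonDyer.BirchSwinnertonDyer.Theorems.KimAtThreeOffStratumAdditiveDefectOfFineKato
import Summits.BirchSwinnertonDyer.BirchSwinnertonDyer.Theorems.KimAtThreeShallowEqDeepSplitGlueNoStub
import Literature.NumberTheory.EllipticCurves.NonEisensteinPrimeOfSurjective
import Literature.NumberTheory.EllipticCurves.PAdicBSDSplitMultiplicativeProofs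
import Literature.NumberTheory.EllipticCurves.PAdicLFunctionNonsplitMultiplicativeExistenceProofs
import HarnessLib

/-!
# Route `KimAtThreeKolyvagin` (W2): crux 19599 `ShallowEqDeepOffKatoStratum` — its stub `stub_nonAdditive`
# VERBATIM, the crux BY NAME, and crux 19077 `ShallowEqDeepAtTorsionFree` BY NAME — from the route's published
# leaves and the FINE KATO PACKAGE FAMILY (C1_τ) [good rows] ∧ (C1′₂) [multiplicative rows] ∧ (C1₂)
# [additive-defect rows] ALONE (the OWNER's assembly)

Cell `bsd-addord`, seat `bsd-addord-w2-c4` (gen 10; OWNER of crux 19599, item 19077).  `--supports` 19077.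
HONEST FRAMING: END THEOREMS WITH DISPLAYED HYPOTHESES (no definition, no named fact, no instance, no
`sorry`).  The conclusions are the registered stub text / route decls BY NAME but CONDITIONAL on (i) the
route's cite-only leaves ([S24] Thm 4.4 (1)(2), GZK, Poitou–Tate, and for 19077 also Carayol + crux 19560 BY
NAME) and (ii) THREE displayed CONSTRUCTION-SHAPED packages — (C1_τ) (gen 9), (C1′₂) (gen 10), (C1₂) (seat
acc3 gen 3) — each = crux 19560's debt class (C1) «Kato's `ZetaBody` family with R-κ, the (Λ)-clauses and a
finite-level rider» read through the dual-exponential lattice of ITS rows; so NOTHING is closed, nothing is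
booked, 19560 / 19599 / 19077 stay OPEN; BSD is not proved by any of this.

## What (the OWNER's assembly of 19599 = `ShallowEqDeepOffKatoStratum_of stub₁ stub₂`, BC3 birth skeleton)

* §1 `stub19599_nonAdditive_of_fineKato : [S24](1) → [S24](2) → GZK → PT → (C1_τ)[good] → (C1′₂)[mult] →
  ⟨stub_nonAdditive of `Cruxes/ShallowEqDeepOffKatoStratum/Lines/birth.lean` VERBATIM⟩` — row dispatch
  inside: at a non-additive `3` either good (`3 ∤ N` by `not_dvd_conductorNorm_of_hasGoodReductionAtPrime`;
  gen 9's `shallowEqDeep_row_of_fineKatoτ_of_good`, anomalous allowed) or multiplicative (`3 ∣ N`; `a₃ = ±1`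
  by `IsNewformOf.cuspCoeff_eq_one_and_sq_of_split` / `…_eq_neg_one_and_dvd_of_nonsplit`, so the non-anomaly
  certificate `3 ∤ 3 − a₃` is AUTOMATIC; gen 10's `shallowEqDeep_row_of_fineKato₁₂_of_nonanomalous`, split
  `3 ∣ c₃` included); the place `v₃` and the generator family `η` by `exists_place_three_and_generators`.
* §2 `shallowEqDeepOffKatoStratum_of_leaves_of_fineKatoFamily : [S24](1)(2) → GZK → PT → (C1_τ) → (C1′₂) →
  (C1₂) → ShallowEqDeepOffKatoStratum` — **crux 19599 BY NAME**: the birth composition on §1 and seat acc3's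
  `KimAtThreeOffStratumAdditiveDefectOfFineKato.stub19599_additiveDefect_of_fineKato` (stub₂ ⟸ PUB ∧ (C1₂)).
* §3 `shallowEqDeepAtTorsionFree_of_leaves_of_fineKatoFamily : SakamotoKolyvaginThree → RankEqAnalyticRankLeOne →
  PoitouTateSelmerDuality → CarayolLevelEqConductor → KatoKuriharaPortThreeShared → (C1_τ) → (C1′₂) → (C1₂) →
  ShallowEqDeepAtTorsionFree` — **crux 19077 BY NAME** via gen 4's `shallowEqDeepAtTorsionFree_of_parts_noStub`.

THE PACKAGES (all `∀`-statements over the rows, binders = the stub's: `3`-adic tower, `#E(ℚ₃)[3] = 1`, datum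
`D₀` at the conductor with the lattice clause and degree-minimality, `v₃ ∣ 3`; NO `c₃`, NO Manin constant, NO
period, NO certificate displayed):
(C1_τ)[good: `3 ∤ N`]  `∃ ι κK Λ Λfin`, R-κ ∧ (Λ) ∧ rider (ii_τ) on the Euler-factor lattice
  `(1 ⊗ (3 − a₃δ_w + δ_{w²}))·L_int`, scalar `s·#Ẽ(𝔽₃)` (gen 9: lattice `exp*_ω(H¹(K,T)) = E₃(φ⁻¹)𝓞_K`);
(C1′₂)[mult: `Mult W 3`]  `∃ ι κK Λ Λfin e`, R-κ ∧ (Λ) ∧ RIDER₂ at `(1, e)` (gen 10: `e = v₃(c₃)` in truth);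
(C1₂)[additive defect]  seat acc3's FINEKATO₂ VERBATIM (`∃ ι κK Λ Λfin e`, RIDER₂ at `(0, e)`).
READING (08-28 residual of record, W2): **19599 ⟸ 4 leaves ∧ (C1_τ) ∧ (C1′₂) ∧ (C1₂)**, **19077 ⟸ the same ∧
Carayol ∧ 19560**; every `t = 0` row of W2 off the Kato stratum rests on the (C1)-family and nothing else.
References: [Kato2004Asterisque] (8.1.3), §6.2, Thm. 6.6 (1), §9.4, Thm. 9.7, Thm. 12.5, Ex. 13.3;
[Kim2022StructureSelmer] §3.2.3, Lemma 3.3/3.4, Thm. 3.6, Thm. 3.13, Thm. 1.9 (6); [Kim2025RefinedTNC] Thm 1.1/1.2,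
§8.1.2; [MazurRubin2004] Thm. 3.2.4, 4.4.1, 5.2.12, App. A; [Sakamoto2024] Thm. 4.4; [Silverman1994] IV.10.2(a);
[SilvermanAEC2009] §C.16; [Manin1972]; memo HOME/w2c4/W2C4-MULT-TWOEXP-g10.md.
-/

set_option autoImplicit false
-- the Theorems namespace of a single-conjunct summit repeats the summit name by design (D-0017)
set_option linter.dupNamespace false

noncomputable section

open scoped NumberField TensorProduct ContRepresentation Classical
open CategoryTheory Field Function Finset IsDedekindDomain NumberField WeierstrassCurve
open Rat.HeightOneSpectrum
open Literature.NumberTheory.GaloisRepresentations Literature.NumberTheory.GaloisCohomology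
open Literature.NumberTheory.GaloisRepresentations.DiscreteGaloisModule
open Literature.NumberTheory.EllipticCurves Literature.NumberTheory.EllipticCurves.ModularForms
open Literature.NumberTheory.EllipticCurves.Rank1Residual
open Literature.NumberTheory.EllipticCurves.Kato2004
open Literature.NumberTheory.EllipticCurves.Kato2004.EulerSystemValues
open Summit.BirchSwinnertonDyer.Rank1Residual.GaloisImage
open Summit.BirchSwinnertonDyer.BirchSwinnertonDyer.Theses.KimAtThreeKolyvagin
open Summit.BirchSwinnertonDyer.BirchSwinnertonDyer.Theorems
open Summit.BirchSwinnertonDyer.BirchSwinnertonDyer.Theorems.KimAtThreeKolyvaginDefs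
open Summit.BirchSwinnertonDyer.BirchSwinnertonDyer.Theorems.KimAtThreeShallowEqDeepSplitGlueNoStub

namespace Summit.BirchSwinnertonDyer.BirchSwinnertonDyer.Theorems.KimAtThreeShallowEqDeepNonAdditiveOfFineKato

/-! ### The displayed packages (local notation) -/

/-- Local notation: the TWO-EXPONENT rider clause (ii₂) at depth `j`, torsion slot `t`, defect exponent `e`,
place `v`, for the pair `(Λ, Λf)` (seat acc6's RIDER₂, VERBATIM). -/
local notation3 (prettyPrint := false) "RIDER₂⟦" W' ", " j ", " t' ", " e' ", " v' ", " Λ' ", " Λf "⟧" =>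
  ∀ (r : Finset (HeightOneSpectrum (𝓞 ℚ)))
    (Ψ : H1 (tateRep W' 3) (cycSubgroup 3 0 r) →+
      continuousCohomology 1
        (subgroupRep (WeierstrassCurve.torsionGaloisModule W' (((3 : ℕ) : ℤ) ^ j * ((3 : ℕ) : ℤ))).toTopRep
          (cycSubgroup 3 0 r))),
    (∀ (φ : contOneCocycles (subgroupRep (tateRep W' 3).toTopRep (cycSubgroup 3 0 r)))
        (ψ : contOneCocycles
          (subgroupRep (WeierstrassCurve.torsionGaloisModule W' (((3 : ℕ) : ℤ) ^ j * ((3 : ℕ) : ℤ))).toTopRep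
            (cycSubgroup 3 0 r))),
        (∀ g, ((ψ.1 g : geomTorsion W' (((3 : ℕ) : ℤ) ^ j * ((3 : ℕ) : ℤ))) : geomPoints W') =
          TateModule.proj 3 (j + 1) (φ.1 g)) →
        Ψ (oneCocycleClass _ φ) = oneCocycleClass _ ψ) →
    ∀ (y : H1 (tateRep W' 3) (cycSubgroup 3 0 r))
      (κ₀ : galoisCohomology (WeierstrassCurve.torsionGaloisModule W' (((3 : ℕ) : ℤ) ^ j * ((3 : ℕ) : ℤ))) 1)
      (s : ℤ_[3]),
      resSubgroup (WeierstrassCurve.torsionGaloisModule W' (((3 : ℕ) : ℤ) ^ j * ((3 : ℕ) : ℤ))).toTopRep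
          (cycSubgroup 3 0 r) 1 κ₀ = Ψ y →
      galoisCohomology.localization (WeierstrassCurve.torsionGaloisModule W' (((3 : ℕ) : ℤ) ^ j * ((3 : ℕ) : ℤ)))
          (Sum.inr v') 1 κ₀ ∈ propagatedSelmerStructure W' 3 j (Sum.inr v') →
      (∃ l ∈ cycIntLattice 3 (cycLevel 3 0 r),
          (((3 : ℕ) : ℤ_[3]) ^ t') • Λ' 0 r y - ((s : ℚ_[3]) ⊗ₜ[ℚ] (1 : CyclotomicField (cycLevel 3 0 r) ℚ)) =
            (((3 : ℕ) : ℤ_[3]) ^ (j + 1)) • (l : ℚ_[3] ⊗[ℚ] CyclotomicField (cycLevel 3 0 r) ℚ)) →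
      ((3 ^ e' : ℕ) : ZMod (3 ^ (j + 1))) *
        Λf (galoisCohomology.localization
          (WeierstrassCurve.torsionGaloisModule W' (((3 : ℕ) : ℤ) ^ j * ((3 : ℕ) : ℤ))) (Sum.inr v') 1 κ₀) =
        PadicInt.toZModPow (j + 1) s

/-- Local notation: the TWISTED rider clause (ii_τ) at depth `j`, place `v`, integer model `t₃` of `a₃`, for
the pair `(Λ, Λf)` — premise on the Euler-factor lattice `(1 ⊗ (3 − t₃δ_w + δ_{w²}))·L_int` (`w·[3] = 1`),
scalar `s·(3 − t₃ + 1)` (this seat's gen 9, VERBATIM). -/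
local notation3 (prettyPrint := false) "RIDERτ⟦" W' ", " j ", " v' ", " t3 ", " Λ' ", " Λf "⟧" =>
  ∀ (r : Finset (HeightOneSpectrum (𝓞 ℚ))) (w : (ZMod (cycLevel 3 0 r))ˣ),
    (w : ZMod (cycLevel 3 0 r)) * ((3 : ℕ) : ZMod (cycLevel 3 0 r)) = 1 →
    ∀ (Ψ : H1 (tateRep W' 3) (cycSubgroup 3 0 r) →+
        continuousCohomology 1
          (subgroupRep (WeierstrassCurve.torsionGaloisModule W' (((3 : ℕ) : ℤ) ^ j * ((3 : ℕ) : ℤ))).toTopRep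
            (cycSubgroup 3 0 r))),
      (∀ (φ : contOneCocycles (subgroupRep (tateRep W' 3).toTopRep (cycSubgroup 3 0 r)))
          (ψ : contOneCocycles
            (subgroupRep (WeierstrassCurve.torsionGaloisModule W' (((3 : ℕ) : ℤ) ^ j * ((3 : ℕ) : ℤ))).toTopRep
              (cycSubgroup 3 0 r))),
          (∀ g, ((ψ.1 g : geomTorsion W' (((3 : ℕ) : ℤ) ^ j * ((3 : ℕ) : ℤ))) : geomPoints W') =
            TateModule.proj 3 (j + 1) (φ.1 g)) →
          Ψ (oneCocycleClass _ φ) = oneCocycleClass _ ψ) →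
      ∀ (y : H1 (tateRep W' 3) (cycSubgroup 3 0 r))
        (κ₀ : galoisCohomology (WeierstrassCurve.torsionGaloisModule W' (((3 : ℕ) : ℤ) ^ j * ((3 : ℕ) : ℤ))) 1)
        (s : ℤ_[3]),
        resSubgroup (WeierstrassCurve.torsionGaloisModule W' (((3 : ℕ) : ℤ) ^ j * ((3 : ℕ) : ℤ))).toTopRep
            (cycSubgroup 3 0 r) 1 κ₀ = Ψ y →
        galoisCohomology.localization (WeierstrassCurve.torsionGaloisModule W' (((3 : ℕ) : ℤ) ^ j * ((3 : ℕ) : ℤ)))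
            (Sum.inr v') 1 κ₀ ∈ propagatedSelmerStructure W' 3 j (Sum.inr v') →
        (∃ l ∈ cycIntLattice 3 (cycLevel 3 0 r),
            ((3 : ℕ) : ℤ_[3]) • Λ' 0 r y -
                (((s * (((3 : ℕ) : ℤ_[3]) - (t3 : ℤ_[3]) + 1) : ℤ_[3]) : ℚ_[3]) ⊗ₜ[ℚ]
                  (1 : CyclotomicField (cycLevel 3 0 r) ℚ)) =
              ((3 : ℤ_[3]) ^ (j + 1)) • ∑ g : (ZMod (cycLevel 3 0 r))ˣ,
                ((((((3 : ℕ) : MonoidAlgebra ℤ_[3] (ZMod (cycLevel 3 0 r))ˣ)) -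
                    MonoidAlgebra.single w (t3 : ℤ_[3]) +
                    MonoidAlgebra.single (w ^ 2) (1 : ℤ_[3])).coeff g : ℤ_[3]) : ℚ_[3]) •
                  Algebra.TensorProduct.map (AlgHom.id ℚ ℚ_[3])
                    (sigma (cycLevel 3 0 r) g : CyclotomicField (cycLevel 3 0 r) ℚ →ₐ[ℚ]
                      CyclotomicField (cycLevel 3 0 r) ℚ) l) →
        Λf (galoisCohomology.localization (WeierstrassCurve.torsionGaloisModule W' (((3 : ℕ) : ℤ) ^ j * ((3 : ℕ) : ℤ)))
            (Sum.inr v') 1 κ₀) = PadicInt.toZModPow (j + 1) s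

/-- Local notation: the (Λ)-clauses of DICT3 for the finite-level functional `Λf j` at `v` (onto `ℤ/3^{j+1}` on
`𝓕_can(v)`, kernel the Kummer part). -/
local notation3 (prettyPrint := false) "LAMBDA⟦" W' ", " v' ", " Λf "⟧" =>
  ∀ j : ℕ,
    (∀ c : ZMod (3 ^ (j + 1)), ∃ x ∈ propagatedSelmerStructure W' 3 j (Sum.inr v'), Λf j x = c) ∧
    (∀ x ∈ propagatedSelmerStructure W' 3 j (Sum.inr v'),
      Λf j x = 0 ↔ x ∈ WeierstrassCurve.kummerSelmerStructure W' (((3 : ℕ) : ℤ) ^ j * ((3 : ℕ) : ℤ)) (Sum.inr v'))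

/-- Local notation: Kato's `ZetaBody` FAMILY for `(ι, κK, Λ)` and the cusp form `f'` at level `N'`. -/
local notation3 (prettyPrint := false) "ZBODY⟦" W' ", " N' ", " f' ", " ι' ", " κ' ", " Λ' "⟧" =>
  ∀ (c d a : ℤ) (A : ℕ), 0 < A → Int.gcd c (6 * 3 * A) = 1 → Int.gcd d (6 * 3 * N') = 1 →
    ∃ (z : ∀ (k' : ℕ) (r : (cyclotomicLevelsRat 3 (badPlaces c d A N')).Ideals),
          H1 (tateRep W' 3) ((cyclotomicLevelsRat 3 (badPlaces c d A N')).level k' r.1))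
      (x : ∀ (k' : ℕ) (r : (cyclotomicLevelsRat 3 (badPlaces c d A N')).Ideals),
          CyclotomicField (cycLevel 3 k' r.1) ℚ),
      ZetaBody W' 3 f' ι' κ' Λ' c d a A z x

/-- Local notation: **(C1_τ) at the row `(W, v, D)`** — gen 9's fine Kato package on the Euler-factor lattice
(`t₃` an integer model of `a₃(f)`), instance binders universally quantified. -/
local notation3 (prettyPrint := false) "FINEKATOτ⟦" W' ", " v' ", " N' ", " D' ", " t3 "⟧" =>
  ∀ [ContinuousSMul ℤ_[3] (WeierstrassCurve.tateModule W' 3)] [Module.Free ℤ_[3] (WeierstrassCurve.tateModule W' 3)]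
    [Module.Finite ℤ_[3] (WeierstrassCurve.tateModule W' 3)],
    ∃ (ι : (n : ℕ) → (CyclotomicField n ℚ →+* ℂ)) (κK : ℝ)
      (Λ : ∀ (k' : ℕ) (r : Finset (HeightOneSpectrum (𝓞 ℚ))),
        H1 (tateRep W' 3) (cycSubgroup 3 k' r) →ₗ[ℤ_[3]]
          ℚ_[3] ⊗[ℚ] CyclotomicField (cycLevel 3 k' r) ℚ)
      (Λfin : ∀ j : ℕ, galoisCohomology
        ((WeierstrassCurve.torsionGaloisModule W' (((3 : ℕ) : ℤ) ^ j * ((3 : ℕ) : ℤ))).toLocal (Sum.inr v')) 1 →+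
          ZMod (3 ^ (j + 1))),
      κK ≠ 0 ∧ (∃ u : ℚ, (u : ℝ) = κK ∧ padicValRat 3 u = 0) ∧
      (LAMBDA⟦W', v', Λfin⟧) ∧
      (∀ j : ℕ, RIDERτ⟦W', j, v', t3, Λ, Λfin j⟧) ∧
      ZBODY⟦W', N', (D' : ModularParametrizationData W' N').f, ι, κK, Λ⟧

/-- Local notation: **(C1′₂) at the row `(W, v, D)`** — gen 10's fine Kato package with the two-exponent riders
at torsion slot `1` and ONE defect exponent `e`, instance binders universally quantified. -/
local notation3 (prettyPrint := false) "FINEKATO₁₂⟦" W' ", " v' ", " N' ", " D' "⟧" =>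
  ∀ [ContinuousSMul ℤ_[3] (WeierstrassCurve.tateModule W' 3)] [Module.Free ℤ_[3] (WeierstrassCurve.tateModule W' 3)]
    [Module.Finite ℤ_[3] (WeierstrassCurve.tateModule W' 3)],
    ∃ (ι : (n : ℕ) → (CyclotomicField n ℚ →+* ℂ)) (κK : ℝ)
      (Λ : ∀ (k' : ℕ) (r : Finset (HeightOneSpectrum (𝓞 ℚ))),
        H1 (tateRep W' 3) (cycSubgroup 3 k' r) →ₗ[ℤ_[3]]
          ℚ_[3] ⊗[ℚ] CyclotomicField (cycLevel 3 k' r) ℚ)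
      (Λfin : ∀ j : ℕ, galoisCohomology
        ((WeierstrassCurve.torsionGaloisModule W' (((3 : ℕ) : ℤ) ^ j * ((3 : ℕ) : ℤ))).toLocal (Sum.inr v')) 1 →+
          ZMod (3 ^ (j + 1))) (e : ℕ),
      κK ≠ 0 ∧ (∃ u : ℚ, (u : ℝ) = κK ∧ padicValRat 3 u = 0) ∧
      (LAMBDA⟦W', v', Λfin⟧) ∧
      (∀ j : ℕ, RIDER₂⟦W', j, 1, e, v', Λ, Λfin j⟧) ∧
      ZBODY⟦W', N', (D' : ModularParametrizationData W' N').f, ι, κK, Λ⟧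

/-- Local notation: **(C1_τ) ON THE GOOD ROWS** — the `∀`-package over the good `t = 0` tower rows with the
datum at the conductor (binders of `stub_nonAdditive` + `3 ∤ N` + an integer model `t₃` of `a₃`). -/
local notation3 (prettyPrint := false) "PKGτ_GOOD" =>
  ∀ (W₀ : WeierstrassCurve ℚ) [W₀.IsElliptic] [W₀.IsGloballyMinimal],
    (∀ n : ℕ, W₀.HasSurjectiveModNGaloisRep (3 ^ n : ℕ)) →
    Nat.card {Q : (W₀.baseChange ℚ_[3]).toAffine.Point // (3 : ℕ) • Q = 0} = 1 →
    ∀ {N : ℕ} [NeZero N], N = W₀.conductorNorm ℤ →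
    ∀ (D₀ : ModularParametrizationData W₀ N),
      (∀ z ∈ D₀.L.lattice, ∃ w ∈ periodLattice D₀.f, z = D₀.c * w) →
      (∀ (W₂ : WeierstrassCurve ℚ) [W₂.IsElliptic] (D₂ : ModularParametrizationData W₂ N),
        D₂.f = D₀.f → D₀.modularDegree ≤ D₂.modularDegree) →
      ¬ 3 ∣ N →
    ∀ (v₃ : HeightOneSpectrum (𝓞 ℚ)), ((3 : ℕ) : 𝓞 ℚ) ∈ v₃.asIdeal →
    ∀ (t₃ : ℤ), cuspCoeff D₀.f 3 = t₃ →
      FINEKATOτ⟦W₀, v₃, N, D₀, t₃⟧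

/-- Local notation: **(C1′₂) ON THE MULTIPLICATIVE ROWS** — the `∀`-package over the multiplicative `t = 0` tower
rows with the datum at the conductor (binders of `stub_nonAdditive` + `Mult W₀ 3`). -/
local notation3 (prettyPrint := false) "PKG₁₂_MULT" =>
  ∀ (W₀ : WeierstrassCurve ℚ) [W₀.IsElliptic] [W₀.IsGloballyMinimal],
    (∀ n : ℕ, W₀.HasSurjectiveModNGaloisRep (3 ^ n : ℕ)) →
    Nat.card {Q : (W₀.baseChange ℚ_[3]).toAffine.Point // (3 : ℕ) • Q = 0} = 1 →
    ∀ {N : ℕ} [NeZero N], N = W₀.conductorNorm ℤ →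
    ∀ (D₀ : ModularParametrizationData W₀ N),
      (∀ z ∈ D₀.L.lattice, ∃ w ∈ periodLattice D₀.f, z = D₀.c * w) →
      (∀ (W₂ : WeierstrassCurve ℚ) [W₂.IsElliptic] (D₂ : ModularParametrizationData W₂ N),
        D₂.f = D₀.f → D₀.modularDegree ≤ D₂.modularDegree) →
      W₀.HasMultiplicativeReductionAtPrime 3 →
    ∀ (v₃ : HeightOneSpectrum (𝓞 ℚ)), ((3 : ℕ) : 𝓞 ℚ) ∈ v₃.asIdeal →
      FINEKATO₁₂⟦W₀, v₃, N, D₀⟧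

/-- Local notation: **(C1₂) ON THE ADDITIVE-DEFECT ROWS** — seat acc3's FINEKATO₂
(`KimAtThreeOffStratumAdditiveDefectOfFineKato`), VERBATIM. -/
local notation3 (prettyPrint := false) "PKG₂_DEFECT" =>
  ∀ (W : WeierstrassCurve ℚ) [W.IsElliptic] [W.IsGloballyMinimal]
    [ContinuousSMul ℤ_[3] (W.tateModule 3)] [Module.Free ℤ_[3] (W.tateModule 3)]
    [Module.Finite ℤ_[3] (W.tateModule 3)],
    (∀ m : ℕ, W.HasSurjectiveModNGaloisRep (3 ^ m : ℕ)) →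
    (haveI : Fact (Nat.Prime 3) := ⟨Nat.prime_three⟩; Addv W 3) →
    Nat.card {Q : (W.baseChange ℚ_[3]).toAffine.Point // (3 : ℕ) • Q = 0} = 1 →
    ∀ (v₃ : HeightOneSpectrum (𝓞 ℚ)), ((3 : ℕ) : 𝓞 ℚ) ∈ v₃.asIdeal →
    ∀ {N : ℕ} [NeZero N] (P : ModularParametrizationData W N), N = W.conductorNorm ℤ →
      (∀ z ∈ P.L.lattice, ∃ w ∈ periodLattice P.f, z = P.c * w) →
      (3 ∣ (W.baseChange ℚ_[3]).localTamagawaNumber ℤ_[3] ∨ (3 : ℤ) ∣ P.maninConstant) →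
      ∃ (ι : (n : ℕ) → (CyclotomicField n ℚ →+* ℂ)) (κK : ℝ)
        (Λ : ∀ (k' : ℕ) (r : Finset (HeightOneSpectrum (𝓞 ℚ))),
          H1 (tateRep W 3) (cycSubgroup 3 k' r) →ₗ[ℤ_[3]]
            ℚ_[3] ⊗[ℚ] CyclotomicField (cycLevel 3 k' r) ℚ)
        (Λfin : ∀ j : ℕ, galoisCohomology
          ((W.torsionGaloisModule (((3 : ℕ) : ℤ) ^ j * ((3 : ℕ) : ℤ))).toLocal (Sum.inr v₃)) 1 →+
            ZMod (3 ^ (j + 1))) (e : ℕ),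
        κK ≠ 0 ∧ (∃ u : ℚ, (u : ℝ) = κK ∧ padicValRat 3 u = 0) ∧
        (∀ j : ℕ,
          (∀ c : ZMod (3 ^ (j + 1)), ∃ x ∈ propagatedSelmerStructure W 3 j (Sum.inr v₃), Λfin j x = c) ∧
          (∀ x ∈ propagatedSelmerStructure W 3 j (Sum.inr v₃),
            Λfin j x = 0 ↔ x ∈ W.kummerSelmerStructure (((3 : ℕ) : ℤ) ^ j * ((3 : ℕ) : ℤ)) (Sum.inr v₃))) ∧
        (∀ j : ℕ, RIDER₂⟦W, j, 0, e, v₃, Λ, Λfin j⟧) ∧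
        ∀ (c d a : ℤ) (A : ℕ), 0 < A → Int.gcd c (6 * 3 * A) = 1 → Int.gcd d (6 * 3 * N) = 1 →
          ∃ (z : ∀ (k' : ℕ) (r : (cyclotomicLevelsRat 3 (badPlaces c d A N)).Ideals),
                H1 (tateRep W 3) ((cyclotomicLevelsRat 3 (badPlaces c d A N)).level k' r.1))
            (x : ∀ (k' : ℕ) (r : (cyclotomicLevelsRat 3 (badPlaces c d A N)).Ideals),
                CyclotomicField (cycLevel 3 k' r.1) ℚ),
            ZetaBody W 3 P.f ι κK Λ c d a A z x

/-- Local notation: the `stub_nonAdditive` signature of crux 19599 (BC3 birth skeleton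
`Cruxes/ShallowEqDeepOffKatoStratum/Lines/birth.lean`), VERBATIM. -/
local notation3 (prettyPrint := false) "STUB19599NA" =>
  ∀ (W₀ : WeierstrassCurve ℚ) [W₀.IsElliptic] [W₀.IsGloballyMinimal],
    (∀ n : ℕ, W₀.HasSurjectiveModNGaloisRep (3 ^ n : ℕ)) →
    Nat.card {Q : (W₀.baseChange ℚ_[3]).toAffine.Point // (3 : ℕ) • Q = 0} = 1 → Finite W₀.sha →
    ∀ {N : ℕ} [NeZero N], N = W₀.conductorNorm ℤ →
    ∀ (D₀ : Literature.NumberTheory.EllipticCurves.ModularForms.ModularParametrizationData W₀ N),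
      (∀ z ∈ D₀.L.lattice, ∃ w ∈ Literature.NumberTheory.EllipticCurves.ModularForms.periodLattice D₀.f, z = D₀.c * w) →
      (∀ (W₂ : WeierstrassCurve ℚ) [W₂.IsElliptic]
        (D₂ : Literature.NumberTheory.EllipticCurves.ModularForms.ModularParametrizationData W₂ N),
        D₂.f = D₀.f → D₀.modularDegree ≤ D₂.modularDegree) →
      (∀ r : ℚ, Literature.NumberTheory.EllipticCurves.ratPlusSymbol D₀.f r ≠ 0 →
        0 ≤ padicValRat 3 (Literature.NumberTheory.EllipticCurves.ratPlusSymbol D₀.f r)) →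
      Literature.NumberTheory.EllipticCurves.kuriharaVanishingOrder W₀ 3 D₀.f = 0 →
      ¬ (haveI : Fact (Nat.Prime 3) := ⟨Nat.prime_three⟩;
          Literature.NumberTheory.EllipticCurves.Rank1Residual.Addv W₀ 3) →
      Literature.NumberTheory.EllipticCurves.kuriharaPartialDeepInfty W₀ 3 D₀.f ≤
        Literature.NumberTheory.EllipticCurves.kuriharaPartialInfty W₀ 3 D₀.f

/-! ### §0 Reduction type at `3` versus the conductor -/

/-- **`3 ∤ N_E` ⟹ good reduction at `3`** (Silverman ATAEC IV.10.2(a): `f₃ = 0` iff good reduction; tree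
`factorization_conductorNorm_holds`, `conductorExponent_eq_zero_iff_holds`,
`hasGoodReductionAtPrime_iff_hasGoodReductionAt_holds`). [cite: Silverman1994, IV.10.2(a)] -/
theorem hasGoodReductionAtPrime_three_of_not_dvd_conductorNorm (W : WeierstrassCurve ℚ) [W.IsElliptic]
    (hN3 : ¬ 3 ∣ W.conductorNorm ℤ) : W.HasGoodReductionAtPrime 3 := by
  set wZ : HeightOneSpectrum ℤ := (primesEquiv (R := ℤ)).symm ⟨3, Nat.prime_three⟩ with hwZ
  have hgen : natGenerator wZ = 3 :=
    congrArg (fun s : Nat.Primes ↦ (s : ℕ)) ((primesEquiv (R := ℤ)).apply_symm_apply ⟨3, Nat.prime_three⟩)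
  have hfe : W.conductorExponent wZ = 0 := by
    rw [← factorization_conductorNorm_holds W wZ, hgen]
    exact Nat.factorization_eq_zero_of_not_dvd hN3
  have hgZ : W.HasGoodReductionAt wZ := (conductorExponent_eq_zero_iff_holds wZ W).mp hfe
  exact (W.hasGoodReductionAtPrime_iff_hasGoodReductionAt_holds ⟨3, Nat.prime_three⟩).mpr hgZ

/-! ### §1 `stub_nonAdditive` of crux 19599 from PUB + (C1_τ)[good] + (C1′₂)[mult] -/

set_option backward.isDefEq.respectTransparency false in
/-- **`stub_nonAdditive` of crux 19599 `ShallowEqDeepOffKatoStratum` (BC3 birth skeleton, VERBATIM) from the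
published leaves and the fine Kato packages ALONE**: [S24] Thm 4.4 (1) `hS24`, (2) `hS24₂`, GZK `hGZK`,
Poitou–Tate `hPT` (by name), (C1_τ) on the good rows (`hC1τ`) and (C1′₂) on the multiplicative rows (`hC1m`)
⟹ `∂^{(∞)}_deep(δ̃) ≤ ∂^{(∞)}(δ̃)` at EVERY non-additive `t = 0` tower row with a lattice-optimal degree-minimal
datum at the conductor, `3`-integral plus symbols and `ord(δ̃) = 0`.  Dispatch by the reduction type at `3`: good
(`3 ∤ N`; gen 9's `shallowEqDeep_row_of_fineKatoτ_of_good` at `t₃ = a₃(W)`, anomalous allowed) or multiplicative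
(`3 ∣ N`; `a₃ = ±1` ⇒ the non-anomaly certificate `3 ∤ 3 − a₃` holds; gen 10's
`shallowEqDeep_row_of_fineKato₁₂_of_nonanomalous`, split `3 ∣ c₃` included).  Nothing booked; BSD is not proved
by this. [cite: Kim2025RefinedTNC, Thm 1.2] [cite: Kim2022StructureSelmer, Thm. 1.9 (6), §3.2.3, Lemma 3.3/3.4, Thm. 3.13]
[cite: Sakamoto2024, Thm. 4.4 (p. 926)] [cite: MazurRubin2004, Thm. 5.2.12] [cite: Kato2004Asterisque, Thm. 9.7 (p. 189)]
[cite: Silverman1994, IV.10.2(a)] [cite: SilvermanAEC2009, §C.16] -/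
theorem stub19599_nonAdditive_of_fineKato
    (hS24 : Sakamoto2024.kolyvaginSystems_freeRankOne_zmod_three_pow)
    (hS24₂ : Sakamoto2024.kolyvaginSystems_idealOfBasis_eq_fittingIdeal_zmod_three_pow)
    (hGZK : rank_eq_analyticRank_of_analyticRank_le_one) (hPT : poitouTate_selmerStructure_duality ℚ)
    (hC1τ : PKGτ_GOOD) (hC1m : PKG₁₂_MULT) : STUB19599NA := by
  intro W₀ _ _ htow ht _ N _ hN D₀ hopt hdeg hint hord hA
  obtain ⟨v₃, η, hv₃, hη⟩ := exists_place_three_and_generators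
  have hf := D₀.isNewformOf
  by_cases hgood : W₀.HasGoodReductionAtPrime 3
  · -- good reduction at `3`: `3 ∤ N`, (C1_τ) at `t₃ = a₃(W₀)`
    have hN3 : ¬ 3 ∣ N := by
      rw [hN]
      exact not_dvd_conductorNorm_of_hasGoodReductionAtPrime W₀ hgood
    exact KimAtThreeShallowEqDeepAnomalousRows.shallowEqDeep_row_of_fineKatoτ_of_good W₀ hS24 hS24₂ hGZK hPT
      htow ht D₀ hN hint hord v₃ hv₃ η hη (hf.2 3) hN3
      (hC1τ W₀ htow ht hN D₀ hopt hdeg hN3 v₃ hv₃ (W₀.LFunction 3) (hf.2 3))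
  · -- not good and not additive: multiplicative at `3`, `3 ∣ N`, `a₃ = ±1`
    have hmult : W₀.HasMultiplicativeReductionAtPrime 3 := by
      by_contra hm
      exact hA ⟨hgood, hm⟩
    have h3N : 3 ∣ N := by
      by_contra h3N
      rw [hN] at h3N
      exact hgood (hasGoodReductionAtPrime_three_of_not_dvd_conductorNorm W₀ h3N)
    by_cases hsplit : W₀.HasSplitMultiplicativeReductionAtPrime 3
    · have ht₃ : cuspCoeff D₀.f 3 = ((1 : ℤ) : ℂ) := by
        rw [(hf.cuspCoeff_eq_one_and_sq_of_split hsplit).1, Int.cast_one]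
      have h3a : ¬ (3 : ℤ) ∣ 3 + (if 3 ∣ N then 0 else 1) - (1 : ℤ) := by
        rw [if_pos h3N]; decide
      exact KimAtThreeShallowEqDeepMultTwoExpFineKato.shallowEqDeep_row_of_fineKato₁₂_of_nonanomalous W₀ hS24
        hS24₂ hGZK hPT htow ht D₀ hN hint hord v₃ hv₃ η hη ht₃ h3a
        (hC1m W₀ htow ht hN D₀ hopt hdeg hmult v₃ hv₃)
    · have ht₃ : cuspCoeff D₀.f 3 = ((-1 : ℤ) : ℂ) := by
        rw [(hf.cuspCoeff_eq_neg_one_and_dvd_of_nonsplit hmult hsplit).1, Int.cast_neg, Int.cast_one]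
      have h3a : ¬ (3 : ℤ) ∣ 3 + (if 3 ∣ N then 0 else 1) - (-1 : ℤ) := by
        rw [if_pos h3N]; decide
      exact KimAtThreeShallowEqDeepMultTwoExpFineKato.shallowEqDeep_row_of_fineKato₁₂_of_nonanomalous W₀ hS24
        hS24₂ hGZK hPT htow ht D₀ hN hint hord v₃ hv₃ η hη ht₃ h3a
        (hC1m W₀ htow ht hN D₀ hopt hdeg hmult v₃ hv₃)

/-! ### §2 Crux 19599 BY NAME from the leaves and the three packages -/

/-- **Crux 19599 `ShallowEqDeepOffKatoStratum` BY NAME ⟸ [S24] (1)(2) ∧ GZK ∧ Poitou–Tate ∧ (C1_τ)[good] ∧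
(C1′₂)[mult] ∧ (C1₂)[additive defect]** — the BC3 birth composition `ShallowEqDeepOffKatoStratum_of stub₁ stub₂`
(case split on `Addv W₀ 3`, re-run here) on §1 and seat acc3's
`KimAtThreeOffStratumAdditiveDefectOfFineKato.stub19599_additiveDefect_of_fineKato`.  CONDITIONAL on the displayed
packages; nothing booked; 19599 stays OPEN until the packages are items and land.
[cite: Kim2025RefinedTNC, Thm 1.1, Thm 1.2] [cite: Kim2022StructureSelmer, Thm. 1.9 (6), Thm. 3.13]
[cite: Sakamoto2024, Thm. 4.4 (p. 926)] [cite: MazurRubin2004, Thm. 4.4.1 and Thm. 5.2.12] -/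
theorem shallowEqDeepOffKatoStratum_of_leaves_of_fineKatoFamily
    (hS24 : Sakamoto2024.kolyvaginSystems_freeRankOne_zmod_three_pow)
    (hS24₂ : Sakamoto2024.kolyvaginSystems_idealOfBasis_eq_fittingIdeal_zmod_three_pow)
    (hGZK : rank_eq_analyticRank_of_analyticRank_le_one) (hPT : poitouTate_selmerStructure_duality ℚ)
    (hC1τ : PKGτ_GOOD) (hC1m : PKG₁₂_MULT) (hC1₂ : PKG₂_DEFECT) :
    ShallowEqDeepOffKatoStratum := by
  intro W₀ _ _ htow ht hfin N _ hN D₀ hopt hdeg hint hord hoff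
  by_cases hA : (haveI : Fact (Nat.Prime 3) := ⟨Nat.prime_three⟩; Addv W₀ 3)
  · refine KimAtThreeOffStratumAdditiveDefectOfFineKato.stub19599_additiveDefect_of_fineKato hS24 hS24₂ hGZK hPT
      hC1₂ W₀ htow ht hfin hN D₀ hopt hdeg hint hord hA ?_
    by_contra hcon
    push Not at hcon
    exact hoff ⟨hA, hcon.1, hcon.2⟩
  · exact stub19599_nonAdditive_of_fineKato hS24 hS24₂ hGZK hPT hC1τ hC1m W₀ htow ht hfin hN D₀ hopt hdeg hint
      hord hA

/-! ### §3 Crux 19077 BY NAME from the route's leaves, crux 19560 and the three packages -/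

/-- **Crux 19077 `ShallowEqDeepAtTorsionFree` BY NAME ⟸ the route's four published leaves (`SakamotoKolyvaginThree`
19558, `RankEqAnalyticRankLeOne` 19921, `PoitouTateSelmerDuality` 19559, `CarayolLevelEqConductor` 19467) ∧ crux
19560 `KatoKuriharaPortThreeShared` ∧ (C1_τ) ∧ (C1′₂) ∧ (C1₂)** — gen 4's stub-free glue
`shallowEqDeepAtTorsionFree_of_parts_noStub` on §2.  CONDITIONAL; nothing booked; 19077 stays OPEN.
[cite: Kim2025RefinedTNC, Thm 1.2] [cite: Kim2022StructureSelmer, Thm. 1.9 (6), Thm. 3.13]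
[cite: Sakamoto2024, Thm. 4.4 (p. 926)] [cite: MazurRubin2004, Thm. 4.4.1 and Thm. 5.2.12] [cite: Carayol1986] -/
theorem shallowEqDeepAtTorsionFree_of_leaves_of_fineKatoFamily
    (hSak : SakamotoKolyvaginThree) (hGZK : RankEqAnalyticRankLeOne) (hPT : PoitouTateSelmerDuality)
    (hlev : CarayolLevelEqConductor) (hPort : KatoKuriharaPortThreeShared)
    (hC1τ : PKGτ_GOOD) (hC1m : PKG₁₂_MULT) (hC1₂ : PKG₂_DEFECT) :
    ShallowEqDeepAtTorsionFree :=
  shallowEqDeepAtTorsionFree_of_parts_noStub hSak hGZK hPT hlev hPort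
    (shallowEqDeepOffKatoStratum_of_leaves_of_fineKatoFamily hSak.1 hSak.2 hGZK hPT hC1τ hC1m hC1₂)

end Summit.BirchSwinnertonDyer.BirchSwinnertonDyer.Theorems.KimAtThreeShallowEqDeepNonAdditiveOfFineKato

end
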